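import Summits.NavierStokesRegularity.FunctionalMining.StretchingLaminateEstimates
import HarnessLib

/-!
# K1-Q1 laminate step, part 10: **`laminateStep_holds : LaminateStep`** — the node of the lamination trees is PROVED

Cell `pub-nsfunc` (host summit NavierStokesRegularity, topic `FunctionalMining`), prove seat gen 6. **Search for
candidate a priori estimates; no regularity claim.** Static smooth fields on `T³`; nothing about Navier–Stokes.

The `@[conjecture]` node `LaminateStep` of the dictionary's `StretchingLaminateStep.lean` (one div-free split
`G ↦ (G + (1−λ)c⊗n, G − λc⊗n)`, two scales) is discharged by the construction of parts 1–9: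
rationalise the normal (`kDir`, `aDir`: `n = a·k`, `k ∈ ℤ³`), laminate along `k` with the window profiles of ramp
width `ε₁`, confine the rescaled children to the two plateaus, and choose first `ε₁` and then the fast scale `m`
against the explicit error budget of `LamData.estimates`. With the dictionary's kernel induction
(`StretchingLaminateStepRealization.lean`: `laminateRealization_of_step`) this turns every certified lamination tree
into an UNCONDITIONAL lower bound for `C⋆ = stretchingSupConst`: `69/125`, the record trees, and `C_lam ≤ C⋆`.
-/

noncomputable section

open MeasureTheory Set Filter Topology Function
open scoped ContDiff

namespace Summit.NavierStokesRegularity.FunctionalMining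

open Literature.Analysis Literature.Analysis.FunctionSpaces Literature.Analysis.FunctionSpaces.Torus
open Literature.Analysis.FluidPDE Literature.Analysis.FluidPDE.Torus
open LaminateWindow LaminateDirection WrapStretching Confinement Laminate

namespace LaminateStepProof

/-! ## 1. Rationalising the normal: `n = a · k` with `k ∈ ℤ³` -/

/-- The integer direction `k = (d₀d₁d₂)·n` (common denominator cleared). [ours; bookkeeping] -/
def kDir (s : Split) : Fin 3 → ℤ :=
  ![s.n0.num * s.n1.den * s.n2.den, s.n1.num * s.n0.den * s.n2.den, s.n2.num * s.n0.den * s.n1.den]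

/-- The normal scale `a = 1/(d₀d₁d₂)`. [ours; bookkeeping] -/
def aDir (s : Split) : ℝ := 1 / ((s.n0.den : ℝ) * s.n1.den * s.n2.den)

/-- The amplitude vector `c` as a point of `ℝ³`. [ours; bookkeeping] -/
def cVec (s : Split) : EuclideanSpace ℝ (Fin 3) := WithLp.toLp 2 ![(s.c0 : ℝ), s.c1, s.c2]

/-- The rational normal as a real vector. [ours; bookkeeping] -/
def nVec (s : Split) : Fin 3 → ℝ := ![(s.n0 : ℝ), s.n1, s.n2]

/-- `a · k = n`. [ours; elementary] -/
theorem aDir_mul_kDir (s : Split) (j : Fin 3) : aDir s * (kDir s j : ℝ) = nVec s j := by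
  have h0 : (s.n0.den : ℝ) ≠ 0 := by exact_mod_cast Rat.den_nz s.n0
  have h1 : (s.n1.den : ℝ) ≠ 0 := by exact_mod_cast Rat.den_nz s.n1
  have h2 : (s.n2.den : ℝ) ≠ 0 := by exact_mod_cast Rat.den_nz s.n2
  fin_cases j
  · simp only [aDir, kDir, nVec, Fin.zero_eta, Matrix.cons_val_zero]
    rw [Rat.cast_def s.n0]; push_cast; field_simp
  · simp only [aDir, kDir, nVec, Fin.mk_one, Matrix.cons_val_one, Matrix.cons_val_zero]
    rw [Rat.cast_def s.n1]; push_cast; field_simp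
  · simp only [aDir, kDir, nVec, Fin.reduceFinMk, Matrix.cons_val_two, Matrix.tail_cons, Matrix.head_cons]
    rw [Rat.cast_def s.n2]; push_cast; field_simp

/-- `(d₀d₁d₂) · n_j = k_j` as reals. [ours; elementary] -/
theorem kDir_eq (s : Split) (j : Fin 3) : (kDir s j : ℝ) = ((s.n0.den : ℝ) * s.n1.den * s.n2.den) * nVec s j := by
  have h := aDir_mul_kDir s j
  have hd : ((s.n0.den : ℝ) * s.n1.den * s.n2.den) ≠ 0 := by
    have h0 : (s.n0.den : ℝ) ≠ 0 := by exact_mod_cast Rat.den_nz s.n0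
    have h1 : (s.n1.den : ℝ) ≠ 0 := by exact_mod_cast Rat.den_nz s.n1
    have h2 : (s.n2.den : ℝ) ≠ 0 := by exact_mod_cast Rat.den_nz s.n2
    positivity
  rw [← h, aDir]
  field_simp

/-- `c · k = (d₀d₁d₂)·(c · n) = 0` for a div-free split. [ours; elementary] -/
theorem cVec_dot_kDir (s : Split) (hs : s.dot = 0) : ∑ j, cVec s j * (kDir s j : ℝ) = 0 := by
  have hdot : (s.c0 : ℝ) * s.n0 + s.c1 * s.n1 + s.c2 * s.n2 = 0 := by
    have := congrArg (fun r : ℚ => (r : ℝ)) hs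
    simpa [Split.dot] using this
  simp only [kDir_eq, Fin.sum_univ_three, cVec, nVec]
  show (s.c0 : ℝ) * (((s.n0.den : ℝ) * s.n1.den * s.n2.den) * s.n0) + s.c1 * (((s.n0.den : ℝ) * s.n1.den * s.n2.den) * s.n1) +
    s.c2 * (((s.n0.den : ℝ) * s.n1.den * s.n2.den) * s.n2) = 0
  have e : (s.c0 : ℝ) * (((s.n0.den : ℝ) * s.n1.den * s.n2.den) * s.n0) + s.c1 * (((s.n0.den : ℝ) * s.n1.den * s.n2.den) * s.n1) +
      s.c2 * (((s.n0.den : ℝ) * s.n1.den * s.n2.den) * s.n2) =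
      ((s.n0.den : ℝ) * s.n1.den * s.n2.den) * ((s.c0 : ℝ) * s.n0 + s.c1 * s.n1 + s.c2 * s.n2) := by ring
  rw [e, hdot, mul_zero]

/-- `k ≠ 0` unless `n = 0`. [ours; elementary] -/
theorem kDir_ne_zero (s : Split) (h : ¬ (s.n0 = 0 ∧ s.n1 = 0 ∧ s.n2 = 0)) : kDir s ≠ 0 := by
  intro hk
  have h0 : kDir s 0 = 0 := by rw [hk]; rfl
  have h1 : kDir s 1 = 0 := by rw [hk]; rfl
  have h2 : kDir s 2 = 0 := by rw [hk]; rfl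
  simp only [kDir, Matrix.cons_val_zero, Matrix.cons_val_one, Matrix.head_cons, Matrix.cons_val_two,
    Matrix.tail_cons, mul_eq_zero, Int.natCast_eq_zero, Rat.num_eq_zero] at h0 h1 h2
  have d0 := Rat.den_nz s.n0
  have d1 := Rat.den_nz s.n1
  have d2 := Rat.den_nz s.n2
  apply h
  refine ⟨?_, ?_, ?_⟩
  · rcases h0 with (h | h) | h <;> first | exact h | exact absurd h d1 | exact absurd h d2
  · rcases h1 with (h | h) | h <;> first | exact h | exact absurd h d0 | exact absurd h d2
  · rcases h2 with (h | h) | h <;> first | exact h | exact absurd h d0 | exact absurd h d1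

/-- The real rank-one matrix of the split in the `LamData` form equals `outerM`. [ours; bookkeeping] -/
theorem outerM_eq (s : Split) (i j : Fin 3) : s.outerM i j = cVec s i * nVec s j := by
  fin_cases i <;> fin_cases j <;> rfl

/-- **Construction data realising a split**: for every admissible `(λ, ε)` and div-free split there is a `LamData`
with the prescribed parameters and children whose rank-one matrix is `c ⊗ n`. [ours] -/
theorem exists_lamData (q : LamParam) (s : Split) (hs : s.dot = 0)
    {Ap Am : UnitAddTorus (Fin 3) → EuclideanSpace ℝ (Fin 3)} (hAp : IsSmooth Ap) (hAm : IsSmooth Am) :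
    ∃ D : LamData, D.q = q ∧ D.Ap = Ap ∧ D.Am = Am ∧ D.M = s.outerM := by
  by_cases h : s.n0 = 0 ∧ s.n1 = 0 ∧ s.n2 = 0
  · refine ⟨⟨q, ![1, 0, 0], ?_, 0, 0, by simp, Ap, Am, hAp, hAm⟩, rfl, rfl, rfl, ?_⟩
    · intro hk; have := congrFun hk 0; simp at this
    · funext i j
      rw [outerM_eq]
      have hn : nVec s j = 0 := by
        fin_cases j <;> simp [nVec, h.1, h.2.1, h.2.2]
      simp [LamData.M, hn]
  · refine ⟨⟨q, kDir s, kDir_ne_zero s h, cVec s, aDir s, cVec_dot_kDir s hs, Ap, Am, hAp, hAm⟩, rfl, rfl, rfl, ?_⟩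
    funext i j
    rw [outerM_eq]
    show cVec s i * (aDir s * (kDir s j : ℝ)) = cVec s i * nVec s j
    rw [aDir_mul_kDir]

/-! ## 2. Sup bounds that do not depend on the ramp width -/

/-- Entry bound of a matrix by the sum of the absolute values of its entries. [folklore] -/
theorem abs_le_sum_abs (X : Fin 3 → Fin 3 → ℝ) (i j : Fin 3) : |X i j| ≤ ∑ a, ∑ b, |X a b| := by
  calc |X i j| ≤ ∑ b, |X i b| := Finset.single_le_sum (f := fun b => |X i b|) (fun b _ => abs_nonneg _) (Finset.mem_univ j)
    _ ≤ ∑ a, ∑ b, |X a b| := Finset.single_le_sum (f := fun a => ∑ b, |X a b|) (fun a _ => Finset.sum_nonneg fun b _ => abs_nonneg _)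
        (Finset.mem_univ i)

/-- A uniform entry bound for `∇curl A` over `T³` (compactness). [folklore] -/
theorem exists_gradAt_bound {A : UnitAddTorus (Fin 3) → EuclideanSpace ℝ (Fin 3)} (hA : IsSmooth A) :
    ∃ β : ℝ, 0 ≤ β ∧ ∀ y i j, |gradAt (curlField A) y i j| ≤ β := by
  obtain ⟨β, hβ0, hβ⟩ := exists_forall₃_abs_le (f := fun i j y => gradAt (curlField A) y i j)
    fun i j => (isSmooth_gradAt (isSmooth_curlField hA) i j).continuous
  exact ⟨β, hβ0, fun y i j => hβ i j y⟩

/-! ## 3. Elementary budget arithmetic -/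

/-- The small parameter `η = ε/(S + ε)` is in `(0, 1]` and `η·c ≤ ε` for every `0 ≤ c ≤ S`. [ours; bookkeeping] -/
theorem eta_facts {ε S : ℝ} (hε : 0 < ε) (hS : 0 ≤ S) :
    0 < ε / (S + ε) ∧ ε / (S + ε) ≤ 1 ∧ ∀ c, 0 ≤ c → c ≤ S → ε / (S + ε) * c ≤ ε := by
  have hden : 0 < S + ε := by linarith
  refine ⟨div_pos hε hden, (div_le_one hden).2 (by linarith), fun c hc hcS => ?_⟩
  rw [div_mul_eq_mul_div, div_le_iff₀ hden]
  nlinarith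

/-- The ceiling budget: `24u(β′+u) ≤ ε` when `0 ≤ u ≤ 2η`, `η ≤ 1`, `η·48(β′+2) ≤ ε`. [ours; bookkeeping] -/
theorem ceiling_budget {u η β ε : ℝ} (hu0 : 0 ≤ u) (hu : u ≤ 2 * η) (hη1 : η ≤ 1) (hβ : 0 ≤ β)
    (h : η * (48 * (β + 2)) ≤ ε) : 24 * u * (β + u) ≤ ε := by
  nlinarith [mul_nonneg hu0 hβ, mul_nonneg hu0 hu0]

/-- The cubic remainder budget: `162ρ(β+ρ)² ≤ ε/3` when `0 ≤ ρ ≤ η ≤ 1`, `η·486(β+1)² ≤ ε`. [ours; bookkeeping] -/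
theorem cubic_budget {ρ η β ε : ℝ} (hρ0 : 0 ≤ ρ) (hρ : ρ ≤ η) (hη1 : η ≤ 1) (hβ : 0 ≤ β)
    (h : η * (486 * (β + 1) ^ 2) ≤ ε) : 162 * ρ * (β + ρ) ^ 2 ≤ ε / 3 := by
  have h1 : (β + ρ) ^ 2 ≤ (β + 1) ^ 2 := pow_le_pow_left₀ (by positivity) (by linarith) 2
  have hη0 : 0 ≤ η := hρ0.trans hρ
  have h2 : 162 * ρ * (β + ρ) ^ 2 ≤ 162 * η * (β + 1) ^ 2 :=
    mul_le_mul (by linarith) h1 (by positivity) (by positivity)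
  linarith

/-- The quadratic remainder budget: `9ρ(β+ρ) ≤ ε/3` when `0 ≤ ρ ≤ η ≤ 1`, `η·27(β+1) ≤ ε`. [ours; bookkeeping] -/
theorem quadratic_budget {ρ η β ε : ℝ} (hρ0 : 0 ≤ ρ) (hρ : ρ ≤ η) (hη1 : η ≤ 1) (hβ : 0 ≤ β)
    (h : η * (27 * (β + 1)) ≤ ε) : 9 * ρ * (β + ρ) ≤ ε / 3 := by
  nlinarith [mul_nonneg hρ0 hβ]

end LaminateStepProof

open LaminateStepProof

/-! ## 4. The node -/

set_option maxHeartbeats 400000 in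
/-- **`LaminateStep` HOLDS.** For a trace-free rational state `G`, a div-free split `(λ, c, n)`, smooth child
potentials `A±` with pointwise ceilings `B± ⊇ |ω(G±)|², |ω(G± + ∇curl A±)|²`, and `ε > 0`, the laminate potential
`A = potential((aΦ(k·x))c) + E₊•(A₊)_m + E₋•(A₋)_m` (ramp width `ε₁`, fast scale `m`, both chosen from the explicit
error budget) has production and enstrophy statistics within `ε` of the `λ : (1−λ)` averages of the children's and
pointwise `|ω|² ≤ max B₊ B₋ + ε`. Search for candidate a priori estimates; no regularity claim. [ours] -/
theorem laminateStep_holds : LaminateStep := by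
  intro G s _hG hs hlam0 hlam1 Ap Am hAp hAm Bp Bm hBp hBm hVp hVm ε hε
  have hlam0r : (0 : ℝ) < s.lam := by exact_mod_cast hlam0
  have hlam1r : (s.lam : ℝ) < 1 := by exact_mod_cast hlam1
  -- sup bounds independent of the ramp width
  obtain ⟨βG, hβGdef⟩ : ∃ b : ℝ, b = ∑ a, ∑ b, |G.toMat a b| := ⟨_, rfl⟩
  have hβG : ∀ i j, |G.toMat i j| ≤ βG := fun i j => hβGdef ▸ abs_le_sum_abs _ i j
  have hβG0 : 0 ≤ βG := (abs_nonneg _).trans (hβG 0 0)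
  obtain ⟨βM, hβMdef⟩ : ∃ b : ℝ, b = ∑ a, ∑ b, |s.outerM a b| := ⟨_, rfl⟩
  have hβM' : ∀ i j, |s.outerM i j| ≤ βM := fun i j => hβMdef ▸ abs_le_sum_abs _ i j
  have hβM0 : 0 ≤ βM := (abs_nonneg _).trans (hβM' 0 0)
  obtain ⟨βXp, hβXp0, hβXp'⟩ := exists_gradAt_bound hAp
  obtain ⟨βXm, hβXm0, hβXm'⟩ := exists_gradAt_bound hAm
  obtain ⟨βX, hβXdef⟩ : ∃ b : ℝ, b = βXp + βXm := ⟨_, rfl⟩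
  have hβX0 : 0 ≤ βX := by rw [hβXdef]; positivity
  have hβXp : ∀ y i j, |gradAt (curlField Ap) y i j| ≤ βX := fun y i j => (hβXp' y i j).trans (by rw [hβXdef]; linarith)
  have hβXm : ∀ y i j, |gradAt (curlField Am) y i j| ≤ βX := fun y i j => (hβXm' y i j).trans (by rw [hβXdef]; linarith)
  -- the budget
  obtain ⟨β', hβ'⟩ : ∃ b : ℝ, b = βG + βM + βX := ⟨_, rfl⟩
  obtain ⟨βZ, hβZ⟩ : ∃ b : ℝ, b = βG + βM + 2 * βX := ⟨_, rfl⟩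
  have hβ'0 : 0 ≤ β' := by rw [hβ']; positivity
  have hβZ0 : 0 ≤ βZ := by rw [hβZ]; positivity
  obtain ⟨CP, hCP⟩ : ∃ c : ℝ, c = LamData.statPConst βG βM βX := ⟨_, rfl⟩
  obtain ⟨CE, hCE⟩ : ∃ c : ℝ, c = LamData.statEConst βG βM βX := ⟨_, rfl⟩
  have hCP0 : 0 ≤ CP := by rw [hCP]; unfold LamData.statPConst; positivity
  have hCE0 : 0 ≤ CE := by rw [hCE]; unfold LamData.statEConst; positivity
  obtain ⟨S, hS⟩ : ∃ c : ℝ, c = 48 * (β' + 2) + 486 * (βZ + 1) ^ 2 + 27 * (βZ + 1) := ⟨_, rfl⟩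
  have hS0 : 0 ≤ S := by rw [hS]; positivity
  obtain ⟨η, hηdef⟩ : ∃ c : ℝ, c = ε / (S + ε) := ⟨_, rfl⟩
  obtain ⟨hη0, hη1, hηc⟩ := eta_facts hε hS0
  rw [← hηdef] at hη0 hη1 hηc
  have hη48 : η * (48 * (β' + 2)) ≤ ε := hηc _ (by linarith) (by rw [hS]; nlinarith [sq_nonneg (βZ + 1)])
  have hη486 : η * (486 * (βZ + 1) ^ 2) ≤ ε := hηc _ (by positivity) (by rw [hS]; nlinarith)
  have hη27 : η * (27 * (βZ + 1)) ≤ ε := hηc _ (by linarith) (by rw [hS]; nlinarith [sq_nonneg (βZ + 1)])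
  -- the ramp width
  obtain ⟨ε₁, hε₁⟩ : ∃ e : ℝ, e = min (min ((s.lam : ℝ) / 4) ((1 - (s.lam : ℝ)) / 4))
      (min (η / (2 * βM + 1)) (ε / (3 * (CP + CE) + 1))) := ⟨_, rfl⟩
  have hε₁0 : 0 < ε₁ := by
    rw [hε₁]
    exact lt_min (lt_min (by linarith) (by linarith)) (lt_min (div_pos hη0 (by linarith)) (div_pos hε (by linarith)))
  have hε₁a : 4 * ε₁ ≤ (s.lam : ℝ) := by
    have : ε₁ ≤ (s.lam : ℝ) / 4 := by rw [hε₁]; exact (min_le_left _ _).trans (min_le_left _ _)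
    linarith
  have hε₁b : 4 * ε₁ ≤ 1 - (s.lam : ℝ) := by
    have : ε₁ ≤ (1 - (s.lam : ℝ)) / 4 := by rw [hε₁]; exact (min_le_left _ _).trans (min_le_right _ _)
    linarith
  have hε₁η : 2 * ε₁ * βM ≤ η := by
    have h1 : ε₁ ≤ η / (2 * βM + 1) := by rw [hε₁]; exact (min_le_right _ _).trans (min_le_left _ _)
    have h2 : ε₁ * (2 * βM + 1) ≤ η := by rwa [le_div_iff₀ (by linarith)] at h1
    nlinarith
  have hε₁C : ε₁ * CP ≤ ε / 3 ∧ ε₁ * CE ≤ ε / 3 := by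
    have h1 : ε₁ ≤ ε / (3 * (CP + CE) + 1) := by rw [hε₁]; exact (min_le_right _ _).trans (min_le_right _ _)
    have h2 : ε₁ * (3 * (CP + CE) + 1) ≤ ε := by rwa [le_div_iff₀ (by linarith)] at h1
    constructor <;> nlinarith
  -- parameters and construction data
  obtain ⟨q, hqlam, hqeps⟩ : ∃ q : LamParam, q.lam = s.lam ∧ q.eps = ε₁ :=
    ⟨⟨s.lam, ε₁, hε₁0, hε₁a, hε₁b⟩, rfl, rfl⟩
  obtain ⟨D, hDq, hDAp, hDAm, hDM⟩ := exists_lamData q s hs hAp hAm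
  subst hDq hDAp hDAm
  have hβM : ∀ i j, |D.M i j| ≤ βM := fun i j => by rw [hDM]; exact hβM' i j
  -- the child states in the `LamData` vocabulary
  have hGp : (G.layer (1 - s.lam) s).toMat = D.Gp G.toMat := by
    rw [toMat_layer, LamData.Gp, hDM, hqlam]; push_cast; rfl
  have hGm : (G.layer (-s.lam) s).toMat = D.Gm G.toMat := by
    rw [toMat_layer, LamData.Gm, hDM, hqlam]; push_cast; rfl
  unfold Laminate.VortBound at hVp hVm
  rw [hGp] at hBp hVp
  rw [hGm] at hBm hVm
  -- the estimates for every fast scale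
  obtain ⟨K, C, hK0, hC0, hest⟩ := D.estimates G.toMat hβG hβM hβXp hβXm hBp hBm hVp hVm
  -- the fast scale
  obtain ⟨η'', hη''⟩ : ∃ c : ℝ, c = min η (ε / 3) := ⟨_, rfl⟩
  have hη''0 : 0 < η'' := by rw [hη'']; exact lt_min hη0 (by linarith)
  obtain ⟨m, hmdef⟩ : ∃ m : ℕ, m = ⌈(K + C) / η''⌉₊ + 1 := ⟨_, rfl⟩
  have hm1 : 1 ≤ m := by omega
  have hmpos : (0 : ℝ) < m := by exact_mod_cast hm1
  have hKC : (K + C) / m ≤ η'' := by rw [hmdef]; exact div_ceil_le hη''0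
  have hKm : K / m ≤ η := by
    have : K / m ≤ (K + C) / m := div_le_div_of_nonneg_right (by linarith) hmpos.le
    exact this.trans (hKC.trans (by rw [hη'']; exact min_le_left _ _))
  have hCm : C / m ≤ ε / 3 := by
    have : C / m ≤ (K + C) / m := div_le_div_of_nonneg_right (by linarith) hmpos.le
    exact this.trans (hKC.trans (by rw [hη'']; exact min_le_right _ _))
  have hKm0 : 0 ≤ K / m := div_nonneg hK0 hmpos.le
  obtain ⟨hceil, hP, hE⟩ := hest m hm1
  -- conclude
  refine ⟨D.Atot m, D.isSmooth_Atot m, ?_, ?_, ?_⟩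
  · -- production
    have h1 : Laminate.statP G (D.Atot m) = ∫ x, prodBC (D.T G.toMat m x) := rfl
    have h2 : Laminate.statP (G.layer (1 - s.lam) s) D.Ap = ∫ y, prodBC (D.Gp G.toMat + D.XP y) := by
      rw [Laminate.statP, hGp]; rfl
    have h3 : Laminate.statP (G.layer (-s.lam) s) D.Am = ∫ y, prodBC (D.Gm G.toMat + D.XM y) := by
      rw [Laminate.statP, hGm]; rfl
    rw [h1, h2, h3, ← hqlam]
    refine hP.trans ?_
    have hb := cubic_budget hKm0 hKm hη1 hβZ0 hη486
    rw [hβZ] at hb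
    have hc : D.q.eps * LamData.statPConst βG βM βX ≤ ε / 3 := by rw [hqeps, ← hCP]; exact hε₁C.1
    linarith only [hb, hc, hCm]
  · -- enstrophy
    have h1 : Laminate.statE G (D.Atot m) = ∫ x, halfSqM (D.T G.toMat m x) := rfl
    have h2 : Laminate.statE (G.layer (1 - s.lam) s) D.Ap = ∫ y, halfSqM (D.Gp G.toMat + D.XP y) := by
      rw [Laminate.statE, hGp]; rfl
    have h3 : Laminate.statE (G.layer (-s.lam) s) D.Am = ∫ y, halfSqM (D.Gm G.toMat + D.XM y) := by
      rw [Laminate.statE, hGm]; rfl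
    rw [h1, h2, h3, ← hqlam]
    refine hE.trans ?_
    have hb := quadratic_budget hKm0 hKm hη1 hβZ0 hη27
    rw [hβZ] at hb
    have hc : D.q.eps * LamData.statEConst βG βM βX ≤ ε / 3 := by rw [hqeps, ← hCE]; exact hε₁C.2
    linarith only [hb, hc, hCm]
  · -- ceiling
    unfold Laminate.VortBound
    intro x
    have hTx : vortSqM (G.toMat + gradAt (curlField (D.Atot m)) x) = vortSqM (D.T G.toMat m x) := rfl
    have hu0 : 0 ≤ 2 * ε₁ * βM + K / m := add_nonneg (mul_nonneg (mul_nonneg zero_le_two hε₁0.le) hβM0) hKm0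
    have hu : 2 * ε₁ * βM + K / m ≤ 2 * η := by linarith
    have hb : 24 * (2 * ε₁ * βM + K / m) * (β' + (2 * ε₁ * βM + K / m)) ≤ ε := ceiling_budget hu0 hu hη1 hβ'0 hη48
    rw [hβ'] at hb
    have hc := hceil x
    rw [hqeps] at hc
    rw [hTx]
    linarith only [hb, hc]

end Summit.NavierStokesRegularity.FunctionalMining

end
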